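import Summits.Schanuel.Schanuel.Theorems.RootDecomp1KGaugeResidual
import Summits.Schanuel.Schanuel.Theorems.RootDecomp1KHyper18

/-!
# RootDecomp1KHyper — part 20: lens 6, generation 15 «QUAD-ANCHORED CELL» (QuadAnchor.lean), §1–§2

PORT NOTE (census-1 gen 14, 2026-08-31): mechanical port of HOME/decomp-schanuel-lens-6/g15/QuadAnchor.lean (sha256
33b3769ebba3b707421f1904f714795f83021a539b9a6cc0eae0479ee6d6b415, 2400 l; lens farm check rc 0 · 0 sorry · axioms standard,
writer re-check STATUS L1531) in eight chained parts `RootDecomp1KHyper20`–`27` at the section cuts of CENSUS-REQUEST STATUS L1528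
(tools HOME/census/tools/gen14/port/); statements and proofs verbatim, 54 one-line docstrings added, six generic one-liners made
`private`, the two `linter.*` options dropped (two unused binders renamed `_`); `--supports stmt-Schanuel-33363`. This part: the lens's
file header below (verbatim) and §1–§2 (`HyperQuadApprox`, `qpow`, `mvcombo`). Nothing here proves Schanuel; rung 0.

## QuadAnchor — lens 6, gen 15: the REAL-QUADRATIC-ANCHORED cell of the level-3 span residual, decided

Node file of the «barrier-complement carving» seat (decomp-schanuel, lens 6, generation 15) for
`route-Schanuel-RootDecomp1K`, item `HyperLiouvilleSchanuel` (stmt-33363), level `n = 3`, residual of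
record `Rank3SpanResidual` (tree: `RootDecomp1KGaugeResidual`).

THE LEVER (outside the Nesterenko–Waldschmidt product form): Ably's measure of algebraic independence
for `e^{y₁}, …, e^{yₙ}`, `yᵢ ∈ ℚ̄` ℚ-free — the tree's named fact `LWMeasure`, PROVED in the tree
(`Literature.NumberTheory.Transcendental.Ably1994_lindemannWeierstrass_measure_holds`) and taken here,
by the tree convention of `RootDecomp1KHyper04` / `sb_of_hyperLiouville_ratio_of_LW` (Hyper18), as the
hypothesis `(hLW : LWMeasure)` discharged by name — read through the tree's
`LWMeasure → MvPolyMeasure → MvWeakMeasure` chain, and combined with a NEW extraction engine (§3):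
a tuple `θ` with an `MvWeakMeasure` is algebraically free from every real number that is approximable to
every exponential order by elements of a FIXED real quadratic field `ℚ(√D)` (`HyperQuadApprox D`), the
norm `N_{ℚ(√D)/ℚ}` of the specialised relation replacing the rational specialisation of §17k.

THE CELL (§4): a ℚ-free `HyperLinLiouville` triple `z : Fin 3 → ℂ` whose ℤ-span contains a non-zero
rational AND a non-zero rational multiple of a real quadratic irrationality `√D` (`HasRealQuadAnchor z`, a
property of `span_ℤ(z)` alone, hence `GL₃(ℤ)`-re-basing invariant and padding-monotone:
`HasRealQuadAnchor.mono`) has Schanuel's bound `SB 3 z` mod `hLW` (`sb_three_of_realQuadAnchor`); so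
`Rank3SpanResidual` is equivalent, mod `hLW`, to its UN-ANCHORED part (`rank3SpanResidual_iff_unanchored`).
The hyper-small forms of an anchored triple are automatically quadratic approximations of its third
direction (`hyperQuadApprox_of_anchor`), which the engine frees from `(e^{q₁}, e^{q₂√D})`.

THE FAMILY AND THE MEMBER (§5–§7): up to re-basing the cell is the explicit family `(1, √D, y)`,
`√D ∉ ℚ`, `HyperQuadApprox D y` (`sb_three_quadTriple`); the explicit real
`y_Q = Σ_k w_k 2^{−a_k}` (`w_k = 1, √2` alternating, `a_k = hexp k`) gives a member `z_Q = (1, √2, y_Q)`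
that lies in the HYPOTHESIS SET of `Rank3SpanResidual` — `LinearIndependent ℚ z_Q`, `HyperLinLiouville z_Q`
and, UNCONDITIONALLY, `¬ HasHLPairInSpan z_Q` (`not_hasHLPairInSpan_yQ`: plane lemma §6a + LEMMA P §7,
every small form of `z_Q` is an integer multiple of a planted form and is genuinely ternary,
`smallForms_ternary`) — and has `SB 3 z_Q` mod `hLW` (`rank3SpanResidual_instance_yQ`).

No `sorry`, no `axiom`, no `native_decide`, no instance / notation / macro; two predicate `def`s
(`HyperQuadApprox`, `HasRealQuadAnchor`), one statement `def` (`SmallFormsArePlanted`, PROVED in §7),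
data `def`s `qpow`, `mvcombo`, `cvec`, `quadTriple`, `pw`, `yterm`, `yQ`, `pmP`, `pmM`, `hKvec`, `Edef`.
-/

noncomputable section

open Complex IntermediateField Polynomial

namespace Summit.Schanuel.Schanuel.Theorems.RootDecomp1KHyper

namespace HyperCell

/-! ## 1. Hyper-quadratic approximability and the arithmetic of `ℤ[√D]`-powers -/

/-- **`HyperQuadApprox D y`**: the real `y` is approximable to EVERY exponential order by elements
`(a + b√D)/q` of the real quadratic field `ℚ(√D)`, sizes measured by `1 + q + |a| + |b|`:
for every `m` some `β = (a + b√D)/q ≠ y` has `|y − β| < exp(−(1 + q + |a| + |b|)^m)`.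
(With `b = 0` throughout this is hyper-Liouville approximability; the class is a dense `G_δ`.) -/
def HyperQuadApprox (D : ℕ) (y : ℝ) : Prop :=
  ∀ m : ℕ, ∃ (a b : ℤ) (q : ℕ), 0 < q ∧ y ≠ ((a : ℝ) + b * Real.sqrt D) / q ∧
    |y - ((a : ℝ) + b * Real.sqrt D) / q| < Real.exp (-((1 + (q : ℝ) + |(a : ℝ)| + |(b : ℝ)|) ^ m))

/-- Integer coordinates of `(a + bω)^k` for `ω² = D`:
`(a + bω)^k = (qpow D a b k).1 + (qpow D a b k).2 · ω`. -/
def qpow (D a b : ℤ) : ℕ → ℤ × ℤ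
  | 0 => (1, 0)
  | k + 1 => (a * (qpow D a b k).1 + D * b * (qpow D a b k).2,
      b * (qpow D a b k).1 + a * (qpow D a b k).2)

/-- `qpow D a b k` are the integer coordinates of `(a + bω)^k` when `ω² = D`: `(qpow D a b k).1 + (qpow D a b k).2·ω = (a + bω)^k`. -/
theorem qpow_spec {R : Type*} [CommRing R] (D a b : ℤ) {ω : R} (hω : ω ^ 2 = (D : R)) (k : ℕ) :
    ((qpow D a b k).1 : R) + ((qpow D a b k).2 : R) * ω = ((a : R) + (b : R) * ω) ^ k := by
  induction k with
  | zero => simp [qpow]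
  | succ k ih =>
      rw [pow_succ, ← ih]
      simp only [qpow, Int.cast_add, Int.cast_mul]
      linear_combination (-((b : R) * ((qpow D a b k).2 : R))) * hω

/-- Size bound: both coordinates of `qpow D a b k` are at most `((1 + D)(1 + |a| + |b|))^k` in absolute value. -/
theorem qpow_abs_le (D : ℕ) (a b : ℤ) (k : ℕ) :
    |((qpow D a b k).1 : ℝ)| ≤ ((1 + (D : ℝ)) * (1 + |(a : ℝ)| + |(b : ℝ)|)) ^ k ∧
      |((qpow D a b k).2 : ℝ)| ≤ ((1 + (D : ℝ)) * (1 + |(a : ℝ)| + |(b : ℝ)|)) ^ k := by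
  induction k with
  | zero => simp [qpow]
  | succ k ih =>
      obtain ⟨h1, h2⟩ := ih
      set T : ℝ := ((1 + (D : ℝ)) * (1 + |(a : ℝ)| + |(b : ℝ)|)) ^ k with hT
      have hT0 : 0 ≤ T := by positivity
      have hD0 : (0 : ℝ) ≤ D := Nat.cast_nonneg D
      have hbase : |(a : ℝ)| + (D : ℝ) * |(b : ℝ)| ≤ (1 + (D : ℝ)) * (1 + |(a : ℝ)| + |(b : ℝ)|) := by
        nlinarith [abs_nonneg (a : ℝ), abs_nonneg (b : ℝ)]
      have hbase' : |(b : ℝ)| + |(a : ℝ)| ≤ (1 + (D : ℝ)) * (1 + |(a : ℝ)| + |(b : ℝ)|) := by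
        nlinarith [abs_nonneg (a : ℝ), abs_nonneg (b : ℝ)]
      simp only [qpow, Int.cast_add, Int.cast_mul, Int.cast_natCast, pow_succ]
      constructor
      · calc |(a : ℝ) * ((qpow D a b k).1 : ℝ) + (D : ℝ) * b * ((qpow D a b k).2 : ℝ)|
            ≤ |(a : ℝ) * ((qpow D a b k).1 : ℝ)| + |(D : ℝ) * b * ((qpow D a b k).2 : ℝ)| :=
              abs_add_le _ _
          _ = |(a : ℝ)| * |((qpow D a b k).1 : ℝ)| + (D : ℝ) * |(b : ℝ)| * |((qpow D a b k).2 : ℝ)| := by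
              rw [abs_mul, abs_mul, abs_mul, abs_of_nonneg hD0]
          _ ≤ |(a : ℝ)| * T + (D : ℝ) * |(b : ℝ)| * T := by gcongr
          _ = T * (|(a : ℝ)| + (D : ℝ) * |(b : ℝ)|) := by ring
          _ ≤ T * ((1 + (D : ℝ)) * (1 + |(a : ℝ)| + |(b : ℝ)|)) :=
              mul_le_mul_of_nonneg_left hbase hT0
      · calc |(b : ℝ) * ((qpow D a b k).1 : ℝ) + (a : ℝ) * ((qpow D a b k).2 : ℝ)|
            ≤ |(b : ℝ) * ((qpow D a b k).1 : ℝ)| + |(a : ℝ) * ((qpow D a b k).2 : ℝ)| := abs_add_le _ _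
          _ = |(b : ℝ)| * |((qpow D a b k).1 : ℝ)| + |(a : ℝ)| * |((qpow D a b k).2 : ℝ)| := by
              rw [abs_mul, abs_mul]
          _ ≤ |(b : ℝ)| * T + |(a : ℝ)| * T := by gcongr
          _ = T * (|(b : ℝ)| + |(a : ℝ)|) := by ring
          _ ≤ T * ((1 + (D : ℝ)) * (1 + |(a : ℝ)| + |(b : ℝ)|)) :=
              mul_le_mul_of_nonneg_left hbase' hT0

/-! ## 2. Integer combinations `Σ cᵢ Fᵢ` of integer polynomials: value, degree, length -/

variable {n : ℕ}

/-- `Σ_i c_i · F_i ∈ ℤ[X₁, …, Xₙ]` for integers `c_i`. -/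
def mvcombo {ι : Type*} [Fintype ι] (c : ι → ℤ) (F : ι → MvPolynomial (Fin n) ℤ) :
    MvPolynomial (Fin n) ℤ :=
  ∑ i, MvPolynomial.C (c i) * F i

/-- `aeval θ` of the integer combination `mvcombo c F` is the corresponding combination of the values `aeval θ (F i)`. -/
theorem aeval_mvcombo {ι : Type*} [Fintype ι] (c : ι → ℤ) (F : ι → MvPolynomial (Fin n) ℤ)
    (θ : Fin n → ℂ) :
    MvPolynomial.aeval θ (mvcombo c F) = ∑ i, (c i : ℂ) * MvPolynomial.aeval θ (F i) := by
  unfold mvcombo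
  rw [map_sum]
  refine Finset.sum_congr rfl fun i _ => ?_
  rw [map_mul, MvPolynomial.aeval_C, algebraMap_int_eq, eq_intCast]

/-- `eval x` of `mvcombo c F` is `Σ i, c i * eval x (F i)`. -/
theorem eval_mvcombo {ι : Type*} [Fintype ι] (c : ι → ℤ) (F : ι → MvPolynomial (Fin n) ℤ)
    (x : Fin n → ℤ) :
    MvPolynomial.eval x (mvcombo c F) = ∑ i, c i * MvPolynomial.eval x (F i) := by
  unfold mvcombo
  rw [map_sum]
  refine Finset.sum_congr rfl fun i _ => ?_
  rw [map_mul, MvPolynomial.eval_C]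

/-- A common bound for the total degrees of the `F i` bounds the total degree of `mvcombo c F`. -/
theorem totalDegree_mvcombo_le {ι : Type*} [Fintype ι] (c : ι → ℤ) (F : ι → MvPolynomial (Fin n) ℤ)
    {D : ℕ} (hF : ∀ i, (F i).totalDegree ≤ D) : (mvcombo c F).totalDegree ≤ D := by
  unfold mvcombo
  refine (MvPolynomial.totalDegree_finsetSum _ _).trans (Finset.sup_le fun i _ => ?_)
  refine (MvPolynomial.totalDegree_mul _ _).trans ?_
  rw [MvPolynomial.totalDegree_C, zero_add]
  exact hF i

/-- The coefficients of `mvcombo c F` are the corresponding integer combinations of the coefficients of the `F i`. -/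
theorem coeff_mvcombo {ι : Type*} [Fintype ι] (c : ι → ℤ) (F : ι → MvPolynomial (Fin n) ℤ)
    (m : Fin n →₀ ℕ) : (mvcombo c F).coeff m = ∑ i, c i * (F i).coeff m := by
  unfold mvcombo
  rw [MvPolynomial.coeff_sum]
  simp only [MvPolynomial.coeff_C_mul]

/-- `mvlen (Σ cᵢ Fᵢ) ≤ Σ |cᵢ| · mvlen Fᵢ`. -/
theorem mvlen_mvcombo_le {ι : Type*} [Fintype ι] (c : ι → ℤ) (F : ι → MvPolynomial (Fin n) ℤ) :
    mvlen (mvcombo c F) ≤ ∑ i, |c i| * mvlen (F i) := by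
  classical
  set s : Finset (Fin n →₀ ℕ) := Finset.univ.biUnion fun i : ι => (F i).support with hs
  have hFs : ∀ i, (F i).support ⊆ s := fun i =>
    Finset.subset_biUnion_of_mem (fun i : ι => (F i).support) (Finset.mem_univ i)
  have hSs : (mvcombo c F).support ⊆ s := by
    intro m hm
    rw [MvPolynomial.mem_support_iff, coeff_mvcombo] at hm
    by_contra hms
    apply hm
    refine Finset.sum_eq_zero fun i _ => ?_
    have hmi : m ∉ (F i).support := fun h => hms (hFs i h)
    have : (F i).coeff m = 0 := by simpa [MvPolynomial.mem_support_iff] using hmi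
    rw [this, mul_zero]
  rw [mvlen_eq_sum_of_support_subset _ hSs]
  calc ∑ m ∈ s, |(mvcombo c F).coeff m|
      ≤ ∑ m ∈ s, ∑ i, |c i| * |(F i).coeff m| := by
        refine Finset.sum_le_sum fun m _ => ?_
        rw [coeff_mvcombo]
        refine (Finset.abs_sum_le_sum_abs _ _).trans (Finset.sum_le_sum fun i _ => ?_)
        rw [abs_mul]
    _ = ∑ i, |c i| * ∑ m ∈ s, |(F i).coeff m| := by
        rw [Finset.sum_comm]
        refine Finset.sum_congr rfl fun i _ => ?_
        rw [Finset.mul_sum]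
    _ = ∑ i, |c i| * mvlen (F i) := by
        refine Finset.sum_congr rfl fun i _ => ?_
        rw [mvlen_eq_sum_of_support_subset _ (hFs i)]

/-- The product of two combinations of one family `G` is the combination, indexed by pairs, of the products `G j * G k`. -/
theorem mvcombo_mul_mvcombo {K : ℕ} (c d : Fin (K + 1) → ℤ) (G : Fin (K + 1) → MvPolynomial (Fin n) ℤ) :
    mvcombo c G * mvcombo d G =
      mvcombo (fun jk : Fin (K + 1) × Fin (K + 1) => c jk.1 * d jk.2)
        (fun jk => G jk.1 * G jk.2) := by
  unfold mvcombo
  rw [Finset.sum_mul_sum, ← Finset.univ_product_univ, Finset.sum_product]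
  refine Finset.sum_congr rfl fun j _ => Finset.sum_congr rfl fun k _ => ?_
  rw [map_mul]
  ring

/-- The difference of two combinations of one family is the combination with coefficients `c i - d i`. -/
theorem mvcombo_sub_mvcombo {ι : Type*} [Fintype ι] (c d : ι → ℤ) (F : ι → MvPolynomial (Fin n) ℤ) :
    mvcombo c F - mvcombo d F = mvcombo (fun i => c i - d i) F := by
  unfold mvcombo
  rw [← Finset.sum_sub_distrib]
  refine Finset.sum_congr rfl fun i _ => ?_
  rw [map_sub, sub_mul]

/-- Scaling a combination by the constant `C t` multiplies every coefficient by `t`. -/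
theorem C_mul_mvcombo {ι : Type*} [Fintype ι] (t : ℤ) (c : ι → ℤ) (F : ι → MvPolynomial (Fin n) ℤ) :
    MvPolynomial.C t * mvcombo c F = mvcombo (fun i => t * c i) F := by
  unfold mvcombo
  rw [Finset.mul_sum]
  refine Finset.sum_congr rfl fun i _ => ?_
  rw [map_mul, mul_assoc]

end HyperCell

end Summit.Schanuel.Schanuel.Theorems.RootDecomp1KHyper
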